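import Mathlib
import Summits.Ventures.PercRepro2.Defs
import Summits.Ventures.PercRepro2.Independence
import Summits.Ventures.PercRepro2.Graph
import Summits.Ventures.PercRepro2.Exploration
import Summits.Ventures.PercRepro2.Induced
import Summits.Ventures.PercRepro2.HubModel
import Summits.Ventures.PercRepro2.HubLaw
import Summits.Ventures.PercRepro2.HubRootLaw
import Summits.Ventures.PercRepro2.HubConn

/-!
# The Bernstein regrouping of a cubic in Bernstein-1 forms, and the integer hub table
(blind cell PercRepro2, typer-1 g8; MINE2-HUB.md §2 (b), HUB-LEAN-SCOPE.md (S3))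

A **Bernstein-1 form** in the weights `q : ι → R` is `bform q f = Σ_w weight q w · f w`
(a multilinear polynomial in `q` written in the degree-1 Bernstein basis `weight q w`); every
hub mass is one (`prob_toEvent_eq_bform`: `P(toEvent Ψ) = bform q (tableOf Ψ m)` with
`tableOf Ψ m w = Σ_π 1[Ψ w π] m_π`).  The product of three degree-1 basis elements is a
degree-3 Bernstein basis element `bern q k`, `k = prof w₁ w₂ w₃` the profile
(`weight_mul_mul`), so a product of three forms regroups as
`bform q f · bform q g · bform q h = Σ_k bern q k · coef3 f g h k` (`bform_mul_mul`) with
`coef3 f g h k = Σ_{prof = k} f w₁ g w₂ h w₃` — this is MINE2-HUB.md §2 (b) without any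
expansion: the sums are only re-indexed (`Finset.sum_fiberwise`).

For hub masses the coefficient is a cubic in the inner masses with the **integer hub table**
`wTable Ψ₁ Ψ₂ Ψ₃ k π₁ π₂ π₃ = #{(w₁, w₂, w₃) : prof = k, Ψᵢ wᵢ πᵢ}` as coefficients
(`coef3_tableOf`): `coef3 (tableOf Ψ₁ m) (tableOf Ψ₂ m) (tableOf Ψ₃ m) k
= Σ_{π₁ π₂ π₃} W_k(π₁, π₂, π₃) m_{π₁} m_{π₂} m_{π₃}`.  Finally `bern q k ≥ 0` on `[0, 1]^ι`
(`bern_nonneg`).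
-/

namespace Summit.Ventures.PercRepro2.Hub

section Profile

variable {ι : Type*} {R : Type*} [CommRing R]

/-- The profile of a triple of states: `kᵢ = w₁ᵢ + w₂ᵢ + w₃ᵢ`. -/
def prof (w₁ w₂ w₃ : ι → Bool) : ι → Fin 4 := fun i =>
  ⟨(w₁ i).toNat + (w₂ i).toNat + (w₃ i).toNat, by
    have := Bool.toNat_le (w₁ i)
    have := Bool.toNat_le (w₂ i)
    have := Bool.toNat_le (w₃ i)
    omega⟩

/-- The value of the profile. -/
lemma prof_apply (w₁ w₂ w₃ : ι → Bool) (i : ι) :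
    (prof w₁ w₂ w₃ i : ℕ) = (w₁ i).toNat + (w₂ i).toNat + (w₃ i).toNat := rfl

/-- Three Bernoulli factors of one weight multiply to a degree-3 Bernstein factor. -/
lemma edgeFactor_mul_mul (x : R) (b₁ b₂ b₃ : Bool) :
    edgeFactor x b₁ * edgeFactor x b₂ * edgeFactor x b₃ =
      x ^ (b₁.toNat + b₂.toNat + b₃.toNat) * (1 - x) ^ (3 - (b₁.toNat + b₂.toNat + b₃.toNat)) := by
  cases b₁ <;> cases b₂ <;> cases b₃ <;> simp [edgeFactor] <;> ring

/-- A product of three sums is a triple sum. -/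
lemma sum_mul_sum_mul_sum {α β γ : Type*} [Fintype α] [Fintype β] [Fintype γ]
    (f : α → R) (g : β → R) (h : γ → R) :
    (∑ a, f a) * (∑ b, g b) * (∑ c, h c) = ∑ a, ∑ b, ∑ c, f a * g b * h c := by
  rw [Finset.sum_mul_sum]
  simp only [Finset.sum_mul]
  simp only [Finset.mul_sum]

end Profile

section Bernstein

variable {ι : Type*} [Fintype ι] {R : Type*} [CommRing R]

/-- The degree-3 Bernstein basis polynomial of the type vector `k`:
`∏ᵢ qᵢ^{kᵢ} (1 - qᵢ)^{3 - kᵢ}`. -/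
def bern (q : ι → R) (k : ι → Fin 4) : R :=
  ∏ i, q i ^ (k i : ℕ) * (1 - q i) ^ (3 - (k i : ℕ))

/-- **Three degree-1 basis elements multiply to a degree-3 basis element.** -/
theorem weight_mul_mul (q : ι → R) (w₁ w₂ w₃ : ι → Bool) :
    weight q w₁ * weight q w₂ * weight q w₃ = bern q (prof w₁ w₂ w₃) := by
  simp only [weight, bern, prof_apply, ← Finset.prod_mul_distrib]
  exact Finset.prod_congr rfl fun i _ => edgeFactor_mul_mul _ _ _ _

variable [DecidableEq ι]

/-- A Bernstein-1 form: `Σ_w weight q w · f w`. -/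
def bform (q : ι → R) (f : (ι → Bool) → R) : R := ∑ w, weight q w * f w

/-- The degree-3 Bernstein coefficient of a product of three forms:
`Σ_{prof w₁ w₂ w₃ = k} f w₁ · g w₂ · h w₃`. -/
def coef3 (f g h : (ι → Bool) → R) (k : ι → Fin 4) : R :=
  ∑ t : (ι → Bool) × (ι → Bool) × (ι → Bool) with prof t.1 t.2.1 t.2.2 = k,
    f t.1 * g t.2.1 * h t.2.2

/-- A product of three Bernstein-1 forms as a triple sum. -/
lemma bform_mul_mul_eq_sum (q : ι → R) (f g h : (ι → Bool) → R) :
    bform q f * bform q g * bform q h =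
      ∑ t : (ι → Bool) × (ι → Bool) × (ι → Bool),
        weight q t.1 * weight q t.2.1 * weight q t.2.2 * (f t.1 * g t.2.1 * h t.2.2) := by
  unfold bform
  rw [sum_mul_sum_mul_sum]
  simp only [Fintype.sum_prod_type]
  refine Finset.sum_congr rfl fun a _ => Finset.sum_congr rfl fun b _ =>
    Finset.sum_congr rfl fun c _ => ?_
  ring

/-- **The Bernstein regrouping**: a product of three Bernstein-1 forms is a degree-3 Bernstein
form with coefficients `coef3`. -/
theorem bform_mul_mul (q : ι → R) (f g h : (ι → Bool) → R) :
    bform q f * bform q g * bform q h = ∑ k, bern q k * coef3 f g h k := by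
  rw [bform_mul_mul_eq_sum]
  unfold coef3
  simp only [Finset.mul_sum]
  rw [← Finset.sum_fiberwise Finset.univ
    (fun t : (ι → Bool) × (ι → Bool) × (ι → Bool) => prof t.1 t.2.1 t.2.2)]
  refine Finset.sum_congr rfl fun k _ => Finset.sum_congr rfl fun t ht => ?_
  rw [Finset.mem_filter] at ht
  rw [← ht.2, weight_mul_mul]

end Bernstein

section Nonneg

variable {ι : Type*} [Fintype ι] {R : Type*} [CommRing R] [PartialOrder R] [IsOrderedRing R]

/-- The Bernstein basis is nonnegative on `[0, 1]^ι`. -/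
theorem bern_nonneg {q : ι → R} (hq : ∀ i, 0 ≤ q i ∧ q i ≤ 1) (k : ι → Fin 4) :
    0 ≤ bern q k := by
  unfold bern
  refine Finset.prod_nonneg fun i _ => mul_nonneg (pow_nonneg (hq i).1 _) (pow_nonneg ?_ _)
  exact sub_nonneg.2 (hq i).2

end Nonneg

section Table

variable {R : Type*} [CommRing R]

/-- The coefficient table of a hub event with inner masses `m`: `f_Ψ(w) = Σ_π 1[Ψ w π] m_π`. -/
def tableOf (Ψ : HubEvt) (m : (Fin 3 → Bool) → R) : (Fin 7 → Bool) → R :=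
  fun w => ∑ π, if Ψ w π then m π else 0

/-- **The integer hub table** of three hub events:
`W_k(π₁, π₂, π₃) = #{(w₁, w₂, w₃) : prof = k, Ψ₁ w₁ π₁, Ψ₂ w₂ π₂, Ψ₃ w₃ π₃}`. -/
def wTable (Ψ₁ Ψ₂ Ψ₃ : HubEvt) (k : Fin 7 → Fin 4) (π₁ π₂ π₃ : Fin 3 → Bool) : ℕ :=
  ∑ t : (Fin 7 → Bool) × (Fin 7 → Bool) × (Fin 7 → Bool) with prof t.1 t.2.1 t.2.2 = k,
    if Ψ₁ t.1 π₁ && Ψ₂ t.2.1 π₂ && Ψ₃ t.2.2 π₃ then 1 else 0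

/-- Three indicator-weighted masses multiply to the joint indicator. -/
lemma ite_mul_ite_mul_ite (b₁ b₂ b₃ : Bool) (x y z : R) :
    (if b₁ then x else 0) * (if b₂ then y else 0) * (if b₃ then z else 0) =
      (if b₁ && b₂ && b₃ then 1 else 0) * (x * y * z) := by
  cases b₁ <;> cases b₂ <;> cases b₃ <;> simp

/-- **The Bernstein coefficient of three hub masses is a cubic in the inner masses** with the
integer hub table as coefficients. -/
theorem coef3_tableOf (Ψ₁ Ψ₂ Ψ₃ : HubEvt) (m : (Fin 3 → Bool) → R) (k : Fin 7 → Fin 4) :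
    coef3 (tableOf Ψ₁ m) (tableOf Ψ₂ m) (tableOf Ψ₃ m) k =
      ∑ π₁, ∑ π₂, ∑ π₃, (wTable Ψ₁ Ψ₂ Ψ₃ k π₁ π₂ π₃ : R) * (m π₁ * m π₂ * m π₃) := by
  unfold coef3 tableOf wTable
  simp only [sum_mul_sum_mul_sum]
  simp only [Nat.cast_sum, Finset.sum_mul]
  conv_lhs => rw [Finset.sum_comm]
  refine Finset.sum_congr rfl fun π₁ _ => ?_
  conv_lhs => rw [Finset.sum_comm]
  refine Finset.sum_congr rfl fun π₂ _ => ?_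
  conv_lhs => rw [Finset.sum_comm]
  refine Finset.sum_congr rfl fun π₃ _ => Finset.sum_congr rfl fun t _ => ?_
  rw [ite_mul_ite_mul_ite]
  push_cast
  rfl

end Table

section Masses

variable {V : Type*} {E : Type*} [Fintype E] [DecidableEq E] [DecidableEq V] {R : Type*}
  [CommRing R] {ends : E → Sym2 V} {μ : Mark → V}

/-- **Every hub mass is a Bernstein-1 form** in the bundle weights, with the inner masses
`m_π = P(Π = π)` in its table: `P(toEvent Ψ) = bform q (tableOf Ψ m)`. -/
theorem prob_toEvent_eq_bform (hinj : Function.Injective μ) (p : E → R) (Ψ : HubEvt)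
    (m : (Fin 3 → Bool) → R) (hm : ∀ π, prob p {ω | innerPat ends μ ω = π} = m π) :
    prob p (toEvent ends μ Ψ) = bform (bundleProb ends μ p) (tableOf Ψ m) := by
  classical
  rw [prob_toEvent hinj p Ψ]
  simp only [hm]
  unfold bform tableOf
  have key : ∀ π, prob (bundleProb ends μ p) {w | Ψ w π = true} =
      ∑ w, weight (bundleProb ends μ p) w * (if Ψ w π then 1 else 0) := by
    intro π
    unfold prob
    refine Finset.sum_congr rfl fun w _ => ?_
    simp only [Set.indicator_apply, Set.mem_setOf_eq]
    split_ifs <;> simp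
  simp only [key, Finset.sum_mul, Finset.mul_sum]
  conv_lhs => rw [Finset.sum_comm]
  refine Finset.sum_congr rfl fun w _ => Finset.sum_congr rfl fun π _ => ?_
  split_ifs <;> simp

end Masses

end Summit.Ventures.PercRepro2.Hub
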